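import Literature.Geometry.Riemannian.AlmostNonnegRicciFibrationSequential
import Literature.Geometry.Riemannian.CyclicCoverLine
import Literature.Geometry.Riemannian.CyclicCoverCurvature
import HarnessLib

/-!
# Huang–Huang–Wang–Zhu 2026, Main Theorem 1 at `n = 4`, `b₁ = 1`: the covers `M̂ᵢ` of a
contradiction sequence as pointed proper geodesic metric spaces

Fifth reduction file for the named fact
`Literature.Geometry.Riemannian.huangHuangWangZhu2026_fibresOverCircle_four`. The fourth file
(`AlmostNonnegRicciFibrationSequential.lean`) bundled one term of the printed contradiction sequence
(arXiv:2605.24380, §4 p. 13) as `D : CoreDatum κ δ` and reduced the fact to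
"along every sequence `Dᵢ : CoreDatum κ δᵢ`, `δᵢ → 0`, some `Dᵢ` is good". The printed proof then
passes to the covers: "`M̂ᵢ := (M̃ᵢ/[Γᵢ,Γᵢ])/Tᵢ` … `M̂ᵢ/Hᵢ = Mᵢ` … consider the commutative diagram
(4.1) `(M̂ᵢ, p̂ᵢ, Hᵢ) → (ℝˢ × Ŷ, (0ˢ, ŷ_∞), H)`" (p. 13). This file assembles, for a datum `D`, the
cover `D.Cover = CyclicCover D.f₀` with everything the tree knows about it, in the exact types of
the fact (model `𝓡 4`, Mathlib's `ContMDiffRiemannianMetric` turned into the tree's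
`PseudoRiemannianMetric.ofRiemannian`), so that a sequence `D : (i : ℕ) → CoreDatum κ (δ i)` IS a
sequence of pointed proper geodesic metric spaces with isometric deck actions as required by
`PointedGHConv` (`MetricGeometry/PointedGromovHausdorff.lean`):

* `CoreDatum.metric`, `CoreDatum.coverMetric` — `g` and its lift `ĝ = proj^* g` as
  `PseudoRiemannianMetric`s, Riemannian, with their Levi-Civita instances;
* `CoreDatum.edist_metric_eq` — the fact's `riemannianEDist` hypothesis is the tree's `g.edist`
  (`rfl`), whence `dist ≤ 1` and `diam ≤ 1` for `CoreDatum.baseMetricSpace`;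
* `CoreDatum.coverMetricSpace` with: proper (`properSpace_cover`), isometric free deck action
  (`isIsometricVAdd_cover`), noncompact, geodesic (`exists_segment_cover`), cocompact at scale `1`
  (`exists_vadd_mem_closedBall_one`), **a line within distance `1` of every point**
  (`exists_line_cover`), the orbit space isometric to the base;
* the curvature bounds of the datum lifted to the cover: `sec_cover_ge` (`sec ≥ -κ`, Gram form),
  `ricci_cover_ge` (`Ric ≥ -δ ĝ`).

Everything here is a definition with body (abbreviations of existing constructions) or a proved
theorem; no named facts; the analytic core (E) is not touched.

## References

* H. Huang, X.-T. Huang, J. Wang, X. Zhu, arXiv:2605.24380 (2026), §4 p. 13 (the covers `M̂ᵢ`,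
  `M̂ᵢ/Hᵢ = Mᵢ`, diagram (4.1)). [HuangHuangWangZhu2026]
* B. O'Neill, *Semi-Riemannian Geometry* (1983), Ch. 7, pp. 191–192 (Riemannian coverings).
  [ONeill1983]
-/

noncomputable section

open scoped Manifold ContDiff Topology Real
open Function Set Filter Metric Bundle

namespace Literature.Geometry.Riemannian

open Literature.Geometry.Lorentzian Literature.Geometry.Lorentzian.PseudoRiemannianMetric
  Literature.Topology.FourManifolds Literature.Topology.FourManifolds.CircleMaps
  Literature.Topology.FourManifolds.CircleMaps.CyclicCover Literature.Geometry.Manifold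
  Literature.Geometry.MetricGeometry

namespace CoreDatum

variable {κ δ : ℝ} (D : CoreDatum κ δ)

/-! ### The metric and the cover of a datum -/

/-- The Riemannian metric of the datum as a `PseudoRiemannianMetric` (`ofRiemannian`).
[cite: HuangHuangWangZhu2026, §4 p. 13] -/
abbrev metric :
    PseudoRiemannianMetric (𝓡 4) ∞ (EuclideanSpace ℝ (Fin 4)) (TangentSpace (𝓡 4) : D.P → Type _) :=
  ofRiemannian D.g

/-- The metric of a datum is Riemannian. [folklore] -/
theorem isRiemannian_metric : D.metric.IsRiemannian :=
  isRiemannian_ofRiemannian D.g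

/-- **The cover `M̂` of the datum**: the infinite cyclic cover along its circle map.
[cite: HuangHuangWangZhu2026, §4 p. 13] -/
abbrev Cover : Type := CyclicCover D.f₀

/-- **The lifted metric `ĝ = proj^* g` on the cover.** [cite: HuangHuangWangZhu2026, §4 p. 13] -/
abbrev coverMetric : PseudoRiemannianMetric (𝓡 4) ∞ (EuclideanSpace ℝ (Fin 4))
    (TangentSpace (𝓡 4) : D.Cover → Type _) :=
  liftMetric D.f₀ D.metric

/-- The lifted metric is Riemannian. [folklore] -/
theorem isRiemannian_coverMetric : D.coverMetric.IsRiemannian :=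
  isRiemannian_liftMetric D.f₀ D.metric D.isRiemannian_metric

/-- The lifted metric has its Levi-Civita connection (every smooth metric does). [folklore] -/
instance hasLeviCivita_coverMetric : D.coverMetric.HasLeviCivita :=
  D.coverMetric.hasLeviCivita

/-- The base is preconnected (the cover is connected). [folklore] -/
instance preconnectedSpace_base : PreconnectedSpace D.P :=
  preconnectedSpace_of_connectedSpace_cyclicCover D.f₀

/-! ### The base as a metric space of diameter `≤ 1` -/

/-- The metric space structure of `(P, d_g)`. [cite: HuangHuangWangZhu2026, §4 p. 13] -/
abbrev baseMetricSpace : MetricSpace D.P :=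
  D.metric.metricSpace D.isRiemannian_metric

/-- **The fact's distance is the tree's distance**: the `riemannianEDist` of the hypothesis
`diam ≤ 1` of `huangHuangWangZhu2026_fibresOverCircle_four` (Mathlib's Riemannian bundle of `g`)
is the tree's `g.edist` for `ofRiemannian g` — definitionally. [folklore] -/
theorem edist_metric_eq (x y : D.P) :
    D.metric.edist D.isRiemannian_metric x y =
      (letI : Bundle.RiemannianBundle (fun x : D.P ↦ TangentSpace (𝓡 4) x) :=
        ⟨D.g.toContinuousRiemannianMetric.toRiemannianMetric⟩;
        Manifold.riemannianEDist (𝓡 4) x y) :=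
  rfl

/-- `d(x, y) ≤ 1` on the base. [cite: HuangHuangWangZhu2026, §4 p. 13] -/
theorem dist_le_one (x y : D.P) :
    letI := D.baseMetricSpace
    dist x y ≤ 1 := by
  letI := D.baseMetricSpace
  rw [metricSpace_dist, ← ENNReal.toReal_one]
  exact ENNReal.toReal_mono ENNReal.one_ne_top (by rw [edist_metric_eq]; exact D.hdiam x y)

/-- **`diam(P, d_g) ≤ 1`.** [cite: HuangHuangWangZhu2026, §4 p. 13] -/
theorem diam_le_one :
    letI := D.baseMetricSpace
    diam (univ : Set D.P) ≤ 1 := by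
  letI := D.baseMetricSpace
  exact diam_le_of_forall_dist_le zero_le_one fun x _ y _ ↦ D.dist_le_one x y

/-! ### The cover as a pointed proper geodesic metric space with isometric deck action -/

/-- The metric space structure of `(M̂, d̂)`. [cite: HuangHuangWangZhu2026, §4 p. 13] -/
abbrev coverMetricSpace : MetricSpace D.Cover :=
  cyclicCoverMetricSpace D.f₀ D.metric D.isRiemannian_metric

/-- **`M̂` is proper.** [cite: HuangHuangWangZhu2026, §2.1 p. 6 and §4 p. 13] -/
theorem properSpace_cover :
    letI := D.coverMetricSpace
    ProperSpace D.Cover :=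
  properSpace_cyclicCover D.f₀ D.isRiemannian_metric

/-- **The deck group `H ≅ ℤ` acts on `M̂` by isometries.** [cite: HuangHuangWangZhu2026, §4 p. 13] -/
theorem isIsometricVAdd_cover :
    letI := D.coverMetricSpace
    IsIsometricVAdd ℤ D.Cover :=
  isIsometricVAdd_cyclicCover D.f₀ D.isRiemannian_metric

/-- `M̂` is not compact. [folklore] -/
theorem noncompactSpace_cover : NoncompactSpace D.Cover :=
  noncompactSpace_cyclicCover D.f₀

/-- **`M̂` is a geodesic space** (unit-speed minimal segments). [cite: ONeill1983, Ch. 5, Prop. 22] -/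
theorem exists_segment_cover (x y : D.Cover) :
    letI := D.coverMetricSpace
    ∃ σ : ℝ → D.Cover, σ 0 = x ∧ σ (dist x y) = y ∧
      ∀ s ∈ Icc 0 (dist x y), ∀ t ∈ Icc 0 (dist x y), dist (σ s) (σ t) = |s - t| :=
  exists_segment_cyclicCover D.f₀ D.isRiemannian_metric x y

/-- **Cocompactness at scale `1`**: every orbit meets every closed unit ball, `k +ᵥ x̂ ∈ B̄(p̂, 1)`
(`diam ≤ 1`). [cite: HuangHuangWangZhu2026, §4 p. 13] -/
theorem exists_vadd_mem_closedBall_one (p x : D.Cover) :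
    letI := D.coverMetricSpace
    ∃ k : ℤ, k +ᵥ x ∈ closedBall p 1 := by
  letI := D.coverMetricSpace
  letI := D.baseMetricSpace
  obtain ⟨k, hk⟩ := exists_vadd_mem_closedBall_diam D.f₀ D.isRiemannian_metric D.properSpace_cover p x
  exact ⟨k, closedBall_subset_closedBall D.diam_le_one hk⟩

/-- **`M̂` contains a line within distance `1` of any point** (the Cheeger–Gromoll-trick input for
`(M̂ᵢ, p̂ᵢ)`; `exists_isometry_real_cyclicCover` with `diam ≤ 1`).
[cite: HuangHuangWangZhu2026, §4 p. 13] -/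
theorem exists_line_cover (p : D.Cover) :
    letI := D.coverMetricSpace
    ∃ σ : ℝ → D.Cover, Isometry σ ∧ dist (σ 0) p ≤ 1 := by
  letI := D.coverMetricSpace
  letI := D.baseMetricSpace
  obtain ⟨σ, hσ, h0⟩ := exists_isometry_real_cyclicCover D.f₀ D.isRiemannian_metric p
  exact ⟨σ, hσ, h0.trans D.diam_le_one⟩

/-- **`M̂/H = M`**: the orbit space of the deck action with its orbit metric is isometric to the
base. [cite: HuangHuangWangZhu2026, §4 p. 13] -/
def orbitIsometryEquiv :
    letI := D.coverMetricSpace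
    letI := D.baseMetricSpace
    haveI := D.isIsometricVAdd_cover
    MulAction.orbitRel.Quotient (Multiplicative ℤ) D.Cover ≃ᵢ D.P :=
  cyclicCoverOrbitIsometryEquiv D.f₀ D.isRiemannian_metric

/-! ### The curvature bounds on the cover -/

/-- **`sec ≥ -κ` on `M̂`** (Gram form), lifted from the datum.
[cite: HuangHuangWangZhu2026, §4 p. 13] -/
theorem sec_cover_ge (e : D.Cover) (X₀ Y₀ : TangentSpace (𝓡 4) e) :
    -κ * (D.coverMetric.val e X₀ X₀ * D.coverMetric.val e Y₀ Y₀ - D.coverMetric.val e X₀ Y₀ ^ 2) ≤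
      D.coverMetric.curvatureForm D.coverMetric.leviCivita e X₀ Y₀ Y₀ X₀ :=
  sec_liftMetric_ge_of_sec_ge D.f₀ D.metric (fun x X Y ↦ D.hsec x X Y) e X₀ Y₀

/-- **`Ric ≥ -δ ĝ` on `M̂`**, lifted from the datum. [cite: HuangHuangWangZhu2026, §4 p. 13] -/
theorem ricci_cover_ge (e : D.Cover) (w : TangentSpace (𝓡 4) e) :
    -δ * D.coverMetric.val e w w ≤ D.coverMetric.ricci e w w :=
  ricci_liftMetric_ge_of_ricci_ge D.f₀ D.metric (fun x w ↦ D.hric x w) e w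

end CoreDatum

end Literature.Geometry.Riemannian
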